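import Mathlib
import HarnessLib
import Summits.ValiantsHypothesis.ValiantsHypothesis.Theses.MonotoneRestoration
import Literature.Computability.AlgebraicComplexity.ArithCircuit
import Literature.Computability.AlgebraicComplexity.ArithCircuitProofs
import Literature.Computability.AlgebraicComplexity.MonotoneStructure
import Literature.Computability.AlgebraicComplexity.PermanentIrreducible
import Literature.ModelTheory.FiniteModelTheory.CkEquiv
import Summits.ValiantsHypothesis.ValiantsHypothesis.Theorems.MonotoneRestorationMonotoneRestorationQPCosetCount
import Summits.ValiantsHypothesis.ValiantsHypothesis.Theorems.MonotoneRestorationMonotoneRestorationQPSymmetricLB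
import Summits.ValiantsHypothesis.ValiantsHypothesis.Theorems.MonotoneRestorationMonotoneRestorationQPSupportSymmetrisation
import Summits.ValiantsHypothesis.ValiantsHypothesis.Theorems.MonotoneRestorationMonotoneRestorationQPSparseRegime
import Summits.ValiantsHypothesis.ValiantsHypothesis.Theorems.MonotoneRestorationMonotoneRestorationQPBeta
import Literature.Computability.AlgebraicComplexity.SymmetricArithCircuit
import Literature.Computability.AlgebraicComplexity.DawarWilsenach2025Proofs
import Literature.GroupTheory.PermutationGroups.SmallIndexSubgroups
import Summits.ValiantsHypothesis.ValiantsHypothesis.Theorems.MonotoneRestorationQP.Negative.LoadBearing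
import Summits.ValiantsHypothesis.ValiantsHypothesis.Theorems.MonotoneRestorationMonotoneRestorationQPPermSupportCount

/-! # TTRL-lite variant V21336 of `MonotoneRestorationQP` / `stub_symmetricMonotone_choose_le_card` (stmt-ValiantsHypothesis-15886)

Helper (proved); move `lemma_proposal`, op `llm`: the COSET INJECTION behind
`gateSupport_index_le_card` — if extensions `π` of `ρ` and `π'` of `ρ'` send a gate `g` to the
same gate, then `ρ'⁻¹ * ρ` has an extension fixing `g`, namely `π'⁻¹ * π`.
See docs/architecture/ttrl-lite.md. -/

namespace Summit.ValiantsHypothesis.ValiantsHypothesis.Theorems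

open Summit.ValiantsHypothesis.ValiantsHypothesis.Theses.MonotoneRestoration
open Literature.Computability.AlgebraicComplexity

/-- TTRL-lite variant V21336 (lemma_proposal `llm`) of `stub_symmetricMonotone_choose_le_card`
(stmt-ValiantsHypothesis-15886), the coset injection behind `[Sym_n : S_g] ≤ |G|`: if `π` is a
circuit automorphism extending `ρ` and `π'` one extending `ρ'` (Dawar–Wilsenach Def. 3.6) with
`π g = π' g`, then `τ := π'⁻¹ * π` is an automorphism extending `ρ'⁻¹ * ρ` that fixes `g`
(composition and inversion of automorphisms, `IsAutomorphismExtending.trans` / `.inv`). -/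
theorem stub_symmetricMonotone_choose_le_card_var21336 :
    ∀ (n : ℕ) (G : Type) (C : LabelledArithCircuit NNReal (Fin n × Fin n) Unit G)
      (ρ ρ' : Equiv.Perm (Fin n)) (π π' : Equiv.Perm G) (g : G),
      C.IsAutomorphismExtending ρ π → C.IsAutomorphismExtending ρ' π' → π g = π' g →
        ∃ τ : Equiv.Perm G, C.IsAutomorphismExtending (ρ'⁻¹ * ρ) τ ∧ τ g = g := by
  intro n G C ρ ρ' π π' g hπ hπ' hg
  refine ⟨π'⁻¹ * π, hπ.trans hπ'.inv, ?_⟩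
  rw [Equiv.Perm.mul_apply, hg, Equiv.Perm.inv_def, Equiv.symm_apply_apply]

end Summit.ValiantsHypothesis.ValiantsHypothesis.Theorems
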